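import Summits.NavierStokesRegularity.NavierStokesRegularity.Theses.SymmetryModuliCount
import Literature.Analysis.FluidPDE.TypeIAncientMild
import Summits.NavierStokesRegularity.NavierStokesRegularity.Theorems.SymmetryModuliCountForcedSymmetryFutureVertexLiouvilleIrrotational
import Summits.NavierStokesRegularity.NavierStokesRegularity.Theorems.SymmetryModuliCountHelicalEndLiouvilleForwardVanishing

/-!
# `ForcedSymmetry` (stmt-NavierStokesRegularity-4052), line `blow-down-census`: the self-similar leaf at the
# vertex `(0, 0)`

Route `SymmetryModuliCount`, helper of the lead's reshaped skeleton `Cruxes/ForcedSymmetry/Lines/blow_down_census.lean`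
(gen 2). The time-anchor line landed the scaling leaves for vertices strictly INSIDE a backward end
(`stub_interiorVertexVanishing`) and strictly in the FUTURE (`stub_futureVertexLiouvilleIrrotational`, `θ > 0`);
blow-down limits are self-similar about the vertex `(0, 0)` itself — the boundary case, closed here by one backward
time-shift:

* `selfSimilarOriginVertex_vanishes` — an element `W` of the Type-I ancient mild class `A_C`
  (`IsTypeIAncientMild C W`) annihilated on `t < 0` by the scaling generator about the space–time origin,
  `y·∇W + W + 2s ∂ₛW = 0`, vanishes identically. Proof: `t ↦ W(t − 1)` lies in `A_C`
  (`IsTypeIAncientMild.comp_sub_right`) and is annihilated by the scaling generator about the future vertex `(1, 0)`,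
  so the landed future-vertex soliton Liouville theorem (Euler homogeneity ⇒ bounded Leray profile ⇒ constant by
  Tsai 1998, Thm 1, `q = ∞` ⇒ `0` in the Oseen gauge) kills it on `t < 0`, i.e. `W ≡ 0` on `t < −1`; the proved route
  item `BackwardEndVanishing` (`symmetryModuliCount_backwardEndVanishing_proof`, forward uniqueness of bounded mild
  solutions) propagates the vanishing to all `t < 0`.

This is also, verbatim up to `isTypeIAncientMild_iff`, stub S5 `stub_selfSimilarLeafVanishes` of the sibling line
`far-past-energy-ledger` (`selfSimilarLeafVanishes_sig` below restates it over the route's written-out class).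

References: T.-P. Tsai, ARMA 143 (1998), Thm 1 [Tsai1998]; KNSS, Acta Math. 203 (2009), Remark 6.1, §4 [KNSS2009].
-/

noncomputable section

-- the summit and its single problem share the name `NavierStokesRegularity` (D-0017 nested layout)
set_option linter.dupNamespace false

open Set Function Filter Topology

namespace Summit.NavierStokesRegularity.NavierStokesRegularity.Theorems

open Literature.Analysis.FluidPDE

/-- **The self-similar leaf at the vertex `(0,0)`.** An element `W` of the Type-I ancient mild class `A_C`
annihilated on `t < 0` by the scaling generator about the space–time origin, `y·∇W(s) + W(s) + 2s ∂ₛW(s) = 0`,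
vanishes identically on `t < 0` (backward shift by one + the future-vertex soliton Liouville theorem
`stub_futureVertexLiouvilleIrrotational` + `BackwardEndVanishing`). [cite: Tsai1998, Thm 1; KNSS2009, Remark 6.1] -/
theorem selfSimilarOriginVertex_vanishes :
    ∀ (C : ℝ) (W : ℝ → EuclideanSpace ℝ (Fin 3) → EuclideanSpace ℝ (Fin 3)), IsTypeIAncientMild C W →
      (∀ s < 0, ∀ y, fderiv ℝ (W s) y y + W s y + (2 * s) • timeDeriv W s y = 0) →
      ∀ s < 0, ∀ y, W s y = 0 := by
  intro C W hW hss
  have hW' : IsTypeIAncientMild C (fun t => W (t - 1)) := hW.comp_sub_right zero_le_one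
  have hgen : ∀ t < 0, ∀ x, fderiv ℝ ((fun t => W (t - 1)) t) x ((0 : EuclideanSpace ℝ (Fin 3)) + (1 : ℝ) • x)
      + (1 : ℝ) • (fun t => W (t - 1)) t x
      + (2 * (1 : ℝ) * (t - 1)) • timeDeriv (fun t => W (t - 1)) t x = 0 := by
    intro t ht x
    have key := hss (t - 1) (by linarith) x
    have hd : timeDeriv (fun s => W (s - 1)) t x = timeDeriv W (t - 1) x := by
      simp only [timeDeriv_apply]
      exact deriv_comp_sub_const (f := fun s => W s x) (a := (1 : ℝ)) (x := t)
    have e : (2 * (1 : ℝ) * (t - 1)) = 2 * (t - 1) := by ring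
    simp only [zero_add, one_smul, hd, e]
    exact key
  have h0 : ∀ t < 0, ∀ x, (fun t => W (t - 1)) t x = 0 :=
    stub_futureVertexLiouvilleIrrotational C _ hW' 0 1 1 one_ne_zero one_pos hgen
  have h1 : ∀ t < (-1 : ℝ), ∀ x, W t x = 0 := by
    intro t ht x
    have := h0 (t + 1) (by linarith) x
    simpa using this
  exact symmetryModuliCount_backwardEndVanishing_proof C W hW (-1) (by norm_num) h1

/-- The same leaf over the route's WRITTEN-OUT class (smooth on `t < 0`, divergence free, Oseen-mild between
negative times, Type-I rate) — the signature of stub S5 `stub_selfSimilarLeafVanishes` of the sibling line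
`far-past-energy-ledger` of this crux, now a theorem. [cite: Tsai1998, Thm 1; KNSS2009, Remark 6.1] -/
theorem selfSimilarLeafVanishes_sig :
    ∀ (C : ℝ) (U : ℝ → EuclideanSpace ℝ (Fin 3) → EuclideanSpace ℝ (Fin 3)), ContDiffOn ℝ (⊤ : ℕ∞)
    (Function.uncurry U) (Set.Iio 0 ×ˢ Set.univ) ∧ (∀ t < 0,
    Literature.Analysis.FluidPDE.VectorCalculus.IsDivFree (U t)) ∧ (∀ s t : ℝ, s < t → t < 0 → ∀ x, U t
    x = Literature.Analysis.FluidPDE.heatFlow (U s) (t - s) x - ∫ τ in Set.Ioo s t, ∫ y,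
    Literature.Analysis.FluidPDE.oseenKernel (t - τ) (x - y) (U τ y) (U τ y)) ∧
    Literature.Analysis.FluidPDE.HasTypeITimeDecay C U → (∀ t < 0, ∀ x, fderiv ℝ (U t) x x + U t x + (2
    * t) • Literature.Analysis.FluidPDE.timeDeriv U t x = 0) → ∀ t < 0, ∀ x, U t x = 0 :=
  fun C U hU hss => selfSimilarOriginVertex_vanishes C U (isTypeIAncientMild_iff.2 hU) hss

end Summit.NavierStokesRegularity.NavierStokesRegularity.Theorems

end
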